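import Mathlib
import HarnessLib

/-!
# Format C, L-C3b joint tail (design "TJ"): quadratic-form bookkeeping for the matrix form

Route context: Fourier–Galerkin / Schur-complement certificates of Weil positivity on a window ("format C";
cell memo `run/shared/lean/pub/rh-explicit/rh-explicit-weil-10/FORMATC-DESIGN.md` §9.9.7; supporting
stmt-RiemannHypothesis-0098; seat rh-explicit-weil-10).  Pure finite-sum algebra turning the functional joint tail
majorant (`even/odd_tailJJ_majorant`: a polynomial in the row functionals `α_p = Σ_i v_p(i)x_i`) into `xᵀU₂x` for an
explicit entrywise matrix `U₂` (the `hU2` premise of `weilPositivityOn_of_formatC_kernels`):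

* `sum_sum_mul_gram2_eq` (+ `_divL`, `_divR`, `_divLR`) — two-family Gram blocks, with the `1/4` scalings of the
  joint zeta family on either side;
* `sum_sum_mul_diag_eq` (+ `_div`) — diagonal (Gershgorin) blocks;
* `sum_sum_mul_skeletonTJ_eq` — the additive/scalar skeleton of the joint bound (8 + 2 + 4 blocks and the
  remainder diagonal).

Standard axioms; no definitions; no RH claim.
-/

set_option autoImplicit false
-- `Summit.RiemannHypothesis.RiemannHypothesis.…` is the layout-mandated namespace (summit = problem name).
set_option linter.dupNamespace false

noncomputable section

open Finset
open scoped BigOperators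

namespace Summit.RiemannHypothesis.RiemannHypothesis.Theorems.WeilFormatC

/-! ## Gram blocks -/

section Gram

/-- Two-family Gram block: `Σ_iΣ_{i'} x_ix_{i'}·Σ_pΣ_q Z_{pq}u_p(i)w_q(i') = Σ_pΣ_q (u_p·x)(w_q·x)Z_{pq}`. -/
theorem sum_sum_mul_gram2_eq {B DA DB : ℕ} (Z : Fin DA → Fin DB → ℝ) (u : Fin DA → Fin B → ℝ)
    (w : Fin DB → Fin B → ℝ) (x : Fin B → ℝ) :
    ∑ i, ∑ i', x i * x i' * (∑ p, ∑ q, Z p q * u p i * w q i')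
      = ∑ p, ∑ q, (∑ i, u p i * x i) * (∑ i, w q i * x i) * Z p q := by
  have hR : ∀ p q, (∑ i, u p i * x i) * (∑ i, w q i * x i) * Z p q
      = ∑ i, ∑ i', x i * x i' * (Z p q * u p i * w q i') := by
    intro p q
    rw [Finset.sum_mul_sum, Finset.sum_mul]
    refine Finset.sum_congr rfl fun i _ ↦ ?_
    rw [Finset.sum_mul]
    refine Finset.sum_congr rfl fun i' _ ↦ by ring
  calc ∑ i, ∑ i', x i * x i' * (∑ p, ∑ q, Z p q * u p i * w q i')
      = ∑ i, ∑ i', ∑ p, ∑ q, x i * x i' * (Z p q * u p i * w q i') := by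
        refine Finset.sum_congr rfl fun i _ ↦ Finset.sum_congr rfl fun i' _ ↦ ?_
        rw [Finset.mul_sum]
        refine Finset.sum_congr rfl fun p _ ↦ ?_
        rw [Finset.mul_sum]
    _ = ∑ i, ∑ p, ∑ i', ∑ q, x i * x i' * (Z p q * u p i * w q i') :=
        Finset.sum_congr rfl fun i _ ↦ Finset.sum_comm
    _ = ∑ p, ∑ i, ∑ i', ∑ q, x i * x i' * (Z p q * u p i * w q i') := Finset.sum_comm
    _ = ∑ p, ∑ i, ∑ q, ∑ i', x i * x i' * (Z p q * u p i * w q i') :=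
        Finset.sum_congr rfl fun p _ ↦ Finset.sum_congr rfl fun i _ ↦ Finset.sum_comm
    _ = ∑ p, ∑ q, ∑ i, ∑ i', x i * x i' * (Z p q * u p i * w q i') :=
        Finset.sum_congr rfl fun p _ ↦ Finset.sum_comm
    _ = _ := Finset.sum_congr rfl fun p _ ↦ Finset.sum_congr rfl fun q _ ↦ (hR p q).symm

/-- A scaled row functional: `Σ_i (u_i/c)x_i = (Σ_i u_ix_i)/c`. -/
theorem sum_div_mul_eq_sum_mul_div {B : ℕ} (u x : Fin B → ℝ) (c : ℝ) :
    ∑ i, u i / c * x i = (∑ i, u i * x i) / c := by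
  rw [Finset.sum_div]
  exact Finset.sum_congr rfl fun i _ ↦ by ring

/-- Two-family Gram block, first family scaled by `1/c`. -/
theorem sum_sum_mul_gram2_divL_eq {B DA DB : ℕ} (Z : Fin DA → Fin DB → ℝ) (u : Fin DA → Fin B → ℝ)
    (w : Fin DB → Fin B → ℝ) (c : ℝ) (x : Fin B → ℝ) :
    ∑ i, ∑ i', x i * x i' * (∑ p, ∑ q, Z p q * (u p i / c) * w q i')
      = ∑ p, ∑ q, (∑ i, u p i * x i) / c * (∑ i, w q i * x i) * Z p q := by
  rw [sum_sum_mul_gram2_eq Z (fun p i ↦ u p i / c) w x]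
  simp only [sum_div_mul_eq_sum_mul_div]

/-- Two-family Gram block, second family scaled by `1/c`. -/
theorem sum_sum_mul_gram2_divR_eq {B DA DB : ℕ} (Z : Fin DA → Fin DB → ℝ) (u : Fin DA → Fin B → ℝ)
    (w : Fin DB → Fin B → ℝ) (c : ℝ) (x : Fin B → ℝ) :
    ∑ i, ∑ i', x i * x i' * (∑ p, ∑ q, Z p q * u p i * (w q i' / c))
      = ∑ p, ∑ q, (∑ i, u p i * x i) * ((∑ i, w q i * x i) / c) * Z p q := by
  rw [sum_sum_mul_gram2_eq Z u (fun q i ↦ w q i / c) x]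
  simp only [sum_div_mul_eq_sum_mul_div]

/-- Two-family Gram block, both families scaled by `1/c`. -/
theorem sum_sum_mul_gram2_divLR_eq {B DA DB : ℕ} (Z : Fin DA → Fin DB → ℝ) (u : Fin DA → Fin B → ℝ)
    (w : Fin DB → Fin B → ℝ) (c : ℝ) (x : Fin B → ℝ) :
    ∑ i, ∑ i', x i * x i' * (∑ p, ∑ q, Z p q * (u p i / c) * (w q i' / c))
      = ∑ p, ∑ q, (∑ i, u p i * x i) / c * ((∑ i, w q i * x i) / c) * Z p q := by
  rw [sum_sum_mul_gram2_eq Z (fun p i ↦ u p i / c) (fun q i ↦ w q i / c) x]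
  simp only [sum_div_mul_eq_sum_mul_div]

/-- Diagonal (Gershgorin) block: `Σ_iΣ_{i'} x_ix_{i'}·Σ_p G_pu_p(i)u_p(i') = Σ_p (u_p·x)²G_p`. -/
theorem sum_sum_mul_diag_eq {B D : ℕ} (G : Fin D → ℝ) (u : Fin D → Fin B → ℝ) (x : Fin B → ℝ) :
    ∑ i, ∑ i', x i * x i' * (∑ p, G p * u p i * u p i') = ∑ p, (∑ i, u p i * x i) ^ 2 * G p := by
  have hR : ∀ p, (∑ i, u p i * x i) ^ 2 * G p = ∑ i, ∑ i', x i * x i' * (G p * u p i * u p i') := by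
    intro p
    rw [sq, Finset.sum_mul_sum, Finset.sum_mul]
    refine Finset.sum_congr rfl fun i _ ↦ ?_
    rw [Finset.sum_mul]
    refine Finset.sum_congr rfl fun i' _ ↦ by ring
  calc ∑ i, ∑ i', x i * x i' * (∑ p, G p * u p i * u p i')
      = ∑ i, ∑ i', ∑ p, x i * x i' * (G p * u p i * u p i') := by
        refine Finset.sum_congr rfl fun i _ ↦ Finset.sum_congr rfl fun i' _ ↦ ?_
        rw [Finset.mul_sum]
    _ = ∑ i, ∑ p, ∑ i', x i * x i' * (G p * u p i * u p i') :=
        Finset.sum_congr rfl fun i _ ↦ Finset.sum_comm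
    _ = ∑ p, ∑ i, ∑ i', x i * x i' * (G p * u p i * u p i') := Finset.sum_comm
    _ = _ := Finset.sum_congr rfl fun p _ ↦ (hR p).symm

/-- Diagonal block with the family scaled by `1/c`. -/
theorem sum_sum_mul_diag_div_eq {B D : ℕ} (G : Fin D → ℝ) (u : Fin D → Fin B → ℝ) (c : ℝ) (x : Fin B → ℝ) :
    ∑ i, ∑ i', x i * x i' * (∑ p, G p * (u p i / c) * (u p i' / c)) = ∑ p, ((∑ i, u p i * x i) / c) ^ 2 * G p := by
  rw [sum_sum_mul_diag_eq G (fun p i ↦ u p i / c) x]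
  simp only [sum_div_mul_eq_sum_mul_div]

end Gram

/-! ## The skeleton of the joint bound -/

section Skeleton

/-- The additive/scalar skeleton of the joint (`TJ`) tail bound as a quadratic form: fourteen blocks
`T₁…T₈` (joint zeta Gram), `A₁, A₂` (A-family zeta Gram), `G₁…G₄` (Gershgorin diagonals) and the remainder
diagonal `s·c_i·t`. -/
theorem sum_sum_mul_skeletonTJ_eq {B : ℕ} (x : Fin B → ℝ) (k c1 c2 e1 e2 e3 s t : ℝ)
    (T1 T2 T3 T4 T5 T6 T7 T8 A1 A2 G1 G2 G3 G4 : Fin B → Fin B → ℝ) (c : Fin B → ℝ) :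
    ∑ i, ∑ i', x i * x i' * (k * (c1 * (((T1 i i' + T2 i i') + (T3 i i' + T4 i i')) + ((T5 i i' + T6 i i') + (T7 i i' + T8 i i')))
        + c2 * (A1 i i' + A2 i i') + e1 * G1 i i' + e2 * G2 i i' + e3 * (G3 i i' + G4 i i'))
        + (if i = i' then s * c i * t else 0))
      = k * (c1 * ((((∑ i, ∑ i', x i * x i' * T1 i i') + ∑ i, ∑ i', x i * x i' * T2 i i')
              + ((∑ i, ∑ i', x i * x i' * T3 i i') + ∑ i, ∑ i', x i * x i' * T4 i i'))
            + (((∑ i, ∑ i', x i * x i' * T5 i i') + ∑ i, ∑ i', x i * x i' * T6 i i')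
              + ((∑ i, ∑ i', x i * x i' * T7 i i') + ∑ i, ∑ i', x i * x i' * T8 i i')))
          + c2 * ((∑ i, ∑ i', x i * x i' * A1 i i') + ∑ i, ∑ i', x i * x i' * A2 i i')
          + e1 * (∑ i, ∑ i', x i * x i' * G1 i i') + e2 * (∑ i, ∑ i', x i * x i' * G2 i i')
          + e3 * ((∑ i, ∑ i', x i * x i' * G3 i i') + ∑ i, ∑ i', x i * x i' * G4 i i'))
        + s * (∑ i, c i * x i ^ 2) * t := by
  have h : ∀ i i', x i * x i' * (k * (c1 * (((T1 i i' + T2 i i') + (T3 i i' + T4 i i')) + ((T5 i i' + T6 i i') + (T7 i i' + T8 i i')))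
        + c2 * (A1 i i' + A2 i i') + e1 * G1 i i' + e2 * G2 i i' + e3 * (G3 i i' + G4 i i'))
        + (if i = i' then s * c i * t else 0))
      = k * (c1 * (x i * x i' * T1 i i')) + k * (c1 * (x i * x i' * T2 i i')) + k * (c1 * (x i * x i' * T3 i i'))
        + k * (c1 * (x i * x i' * T4 i i')) + k * (c1 * (x i * x i' * T5 i i')) + k * (c1 * (x i * x i' * T6 i i'))
        + k * (c1 * (x i * x i' * T7 i i')) + k * (c1 * (x i * x i' * T8 i i'))
        + k * (c2 * (x i * x i' * A1 i i')) + k * (c2 * (x i * x i' * A2 i i'))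
        + k * (e1 * (x i * x i' * G1 i i')) + k * (e2 * (x i * x i' * G2 i i'))
        + k * (e3 * (x i * x i' * G3 i i')) + k * (e3 * (x i * x i' * G4 i i'))
        + x i * x i' * (if i = i' then s * c i * t else 0) := by
    intro i i'; ring
  simp only [h, Finset.sum_add_distrib, ← Finset.mul_sum]
  have hite : ∑ i, ∑ i', x i * x i' * (if i = i' then s * c i * t else 0) = s * (∑ i, c i * x i ^ 2) * t := by
    rw [Finset.mul_sum, Finset.sum_mul]
    refine Finset.sum_congr rfl fun i _ ↦ ?_
    simp only [mul_ite, mul_zero, Finset.sum_ite_eq, Finset.mem_univ, if_true]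
    ring
  rw [hite]
  ring

end Skeleton

end Summit.RiemannHypothesis.RiemannHypothesis.Theorems.WeilFormatC

end
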